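import Literature.NumberTheory.EllipticCurves.HeegnerPointsKolyvaginStructure
import Literature.NumberTheory.EllipticCurves.Isogeny
import Literature.NumberTheory.EllipticCurves.GlobalMinimalModelProofs
import HarnessLib

/-!
# Route `KolyvaginDepthDoor` — definitions posited by the route's helpers (crux `KolyvaginDepthSupply`,
# stmt-BirchSwinnertonDyer-21765)

Definitions file of the route (`Theorems/<RouteSlug>Defs.lean`, reviewed); it asserts nothing and BSD is
not proved by it.

* `KolyvaginDepthSupplySystem` — the SYSTEM / LEVEL-ONE form of the crux `KolyvaginDepthSupply`
  suggested by the hF-free, twist-free door of this route (`door_of_hypothesesDepth`,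
  `shaCorank_eq_zero_of_kolyvaginClass_ne_zero_of_rank_le_of_print`): for every non-CM globally minimal
  elliptic `E/ℚ` there are a prime `p ≥ 5` of good ordinary reduction with `ρ̄_{E,p^n}` onto for all
  `n` (`p ∈ B(E)`), an imaginary quadratic `K` (`d_K ∉ {−3, −4}`, Heegner hypothesis for `N_E`), a
  frame `(Dt, β, ι)`, a COMPATIBLE system `d n : KolyvaginHeegnerData Dt β ι n` of Kolyvagin–Heegner data
  (McCallum's one system of choices: `σ`, `S`, `emb` restrict along `K[m] ⊆ K[mℓ]`), and a square-free
  product `n₁` of Kolyvagin primes (W. Zhang's congruence form) with the LEVEL-ONE class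
  `(d n₁).kolyvaginClass hp 1 ≠ 0` and `ν(n₁) + 1 ≤ rank E(ℚ)`.
  Compared with `KolyvaginDepthSupply`: no minimality clause, no level `M ≤ M(n)`, no twist-rank clause,
  no `p ∤ d_K N` — but a SYSTEM instead of one datum, and the class at level `p¹`. Modulo the five S/M
  McCallum/Gross leaves it implies X1 on non-CM curves (`…KolyvaginDepthSupplySystemDoor`), with NO appeal
  to Kolyvagin 1991 Thm. 4 (the route's XL support item `KolyvaginStructure`) and no point on the twist;
  per curve it is decided by ONE bit (given a compatible system). A planner may file it as a replacement
  crux; nothing here does so.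

References: [Kolyvagin1991MathAnn] §1 (the classes `τ_{λ,n}`), Thm. 2.3; [GrossLMS1991] §§3–5;
[McCallumLMS1991] §§4–5; [WZhang2014] Notations (xii).
-/

set_option linter.dupNamespace false

noncomputable section

open scoped Classical

namespace Summit.BirchSwinnertonDyer.BirchSwinnertonDyer.Theorems.KolyvaginDepthDoor

open Literature.NumberTheory.EllipticCurves Literature.NumberTheory.EllipticCurves.ModularForms
  WeierstrassCurve

/-- **`KolyvaginDepthSupplySystem`** — the system / level-one form of the crux `KolyvaginDepthSupply`
(see the module docstring): for every non-CM globally minimal elliptic `E/ℚ`, a prime `p ≥ 5` of good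
ordinary reduction with `ρ̄_{E,p^n}` onto for all `n`, an imaginary quadratic Heegner field `K`
(`d_K ∉ {−3, −4}`), a frame `(Dt, β, ι)`, a COMPATIBLE system `d` of Kolyvagin–Heegner data, and a
square-free product `n₁` of Kolyvagin primes (Zhang's form) with `(d n₁).kolyvaginClass hp 1 ≠ 0` and
`#{q ∣ n₁} + 1 ≤ rank E(ℚ)`. A definition posited by this route's helpers (the objects are Kolyvagin's
classes `τ_{λ,n}` of Math. Ann. 291, §1, in the tree's currency `KolyvaginHeegnerData.kolyvaginClass`,
and W. Zhang's Kolyvagin primes); an OPEN class-wide statement (tagged `@[conjecture]`), NOT a published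
statement and NOT a ledger item. -/
@[conjecture] def KolyvaginDepthSupplySystem : Prop :=
  ∀ (W : WeierstrassCurve ℚ) [W.IsElliptic] [W.IsGloballyMinimal], ¬ W.HasCM →
    ∃ (p : ℕ) (hp : Fact p.Prime), 5 ≤ p ∧ W.HasGoodReductionAtPrime p ∧
      ¬ (p : ℤ) ∣ W.frobeniusTrace p ∧ (∀ n : ℕ, W.HasSurjectiveModNGaloisRep (p ^ n : ℕ)) ∧
      ∃ (K : Type) (_ : Field K) (_ : NumberField K), IsImaginaryQuadratic K ∧
        NumberField.discr K ≠ -3 ∧ NumberField.discr K ≠ -4 ∧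
        ∃ (_ : NeZero (W.conductorNorm ℤ)), SatisfiesHeegnerHypothesis (W.conductorNorm ℤ) K ∧
        ∃ (Dt : ModularParametrizationData W (W.conductorNorm ℤ)) (β : ℤ) (ι : K →+* ℂ)
          (d : ∀ n : ℕ, KolyvaginHeegnerData Dt β ι n),
          (∀ (m l : ℕ), ∀ l' ∈ m.primeFactors, ∀ (x : ringClassField K ι m)
            (x' : ringClassField K ι (m * l)), (x : ℂ) = x' →
            (((d (m * l)).σ l' x' : ringClassField K ι (m * l)) : ℂ) = ((d m).σ l' x : ℂ)) ∧
          (∀ (m l : ℕ), ∀ s ∈ (d m).S, ∃ s' ∈ (d (m * l)).S, ∀ (x : ringClassField K ι m)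
            (x' : ringClassField K ι (m * l)), (x : ℂ) = x' →
            ((s' x' : ringClassField K ι (m * l)) : ℂ) = (s x : ℂ)) ∧
          (∀ (m l : ℕ), ∀ s' ∈ (d (m * l)).S, ∃ s ∈ (d m).S, ∀ (x : ringClassField K ι m)
            (x' : ringClassField K ι (m * l)), (x : ℂ) = x' →
            ((s' x' : ringClassField K ι (m * l)) : ℂ) = (s x : ℂ)) ∧
          (∀ (m l : ℕ) (x : ringClassField K ι m) (x' : ringClassField K ι (m * l)),
            (x : ℂ) = x' → (d (m * l)).emb x' = (d m).emb x) ∧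
          ∃ n₁ : ℕ, Squarefree n₁ ∧
            (∀ q ∈ n₁.primeFactors, Zhang2014.IsKolyvaginPrime (W.conductorNorm ℤ) W K p q) ∧
            (d n₁).kolyvaginClass hp.out 1 ≠ 0 ∧ n₁.primeFactors.card + 1 ≤ W.mordellWeilRank

/-- **`KolyvaginDepthSupplyDatum`** — the DATUM form of the crux `KolyvaginDepthSupply` (and of
`KolyvaginDepthSupplySystem` above): for every non-CM globally minimal elliptic `E/ℚ`, a prime `p ≥ 5`
of good ordinary reduction with `ρ̄_{E,p^n}` onto for all `n`, an imaginary quadratic Heegner field `K`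
(`d_K ∉ {−3, −4}`), a frame `(Dt, β, ι)`, a square-free product `n₁` of Kolyvagin primes (W. Zhang's
congruence form) and ONE Kolyvagin–Heegner datum `d` of conductor `n₁` whose LEVEL-ONE class
`d.kolyvaginClass hp 1` is non-zero, with `ν(n₁) + 1 ≤ rank E(ℚ)`. Compared with
`KolyvaginDepthSupplySystem`: NO system and NO compatibility clauses — the compatible system on all
square-free inert levels through any datum is a THEOREM of the tree
(`exists_kolyvaginHeegnerSystem_extending`, file `…KolyvaginHeegnerSystem`), so this form implies X1 on
non-CM curves modulo the same five S/M McCallum/Gross leaves (`…KolyvaginDepthSupplyDatumDoor`), and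
per curve it is decided by ONE bit at ONE datum (the depth table's currency). A definition posited by
this route's helpers; an OPEN class-wide statement (tagged `@[conjecture]`), NOT a published statement
and NOT a ledger item. [cite: Kolyvagin1991MathAnn, §1 (the classes τ_{λ,n}) and Thm. 2.3]
[cite: GrossLMS1991, §3–§4] [cite: WZhang2014, Notations (xii)] -/
@[conjecture] def KolyvaginDepthSupplyDatum : Prop :=
  ∀ (W : WeierstrassCurve ℚ) [W.IsElliptic] [W.IsGloballyMinimal], ¬ W.HasCM →
    ∃ (p : ℕ) (hp : Fact p.Prime), 5 ≤ p ∧ W.HasGoodReductionAtPrime p ∧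
      ¬ (p : ℤ) ∣ W.frobeniusTrace p ∧ (∀ n : ℕ, W.HasSurjectiveModNGaloisRep (p ^ n : ℕ)) ∧
      ∃ (K : Type) (_ : Field K) (_ : NumberField K), IsImaginaryQuadratic K ∧
        NumberField.discr K ≠ -3 ∧ NumberField.discr K ≠ -4 ∧
        ∃ (_ : NeZero (W.conductorNorm ℤ)), SatisfiesHeegnerHypothesis (W.conductorNorm ℤ) K ∧
        ∃ (Dt : ModularParametrizationData W (W.conductorNorm ℤ)) (β : ℤ) (ι : K →+* ℂ) (n₁ : ℕ)
          (d : KolyvaginHeegnerData Dt β ι n₁), Squarefree n₁ ∧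
            (∀ q ∈ n₁.primeFactors, Zhang2014.IsKolyvaginPrime (W.conductorNorm ℤ) W K p q) ∧
            d.kolyvaginClass hp.out 1 ≠ 0 ∧ n₁.primeFactors.card + 1 ≤ W.mordellWeilRank

/-- **`KolyvaginDepthSupplySignedDatum`** — the SIGNED datum form of the crux `KolyvaginDepthSupply`:
the datum form `KolyvaginDepthSupplyDatum` above with the crux's SECOND rank clause RESTORED. For every
non-CM globally minimal elliptic `E/ℚ`: a prime `p ≥ 5` of good ordinary reduction with `ρ̄_{E,p^n}`
onto for all `n`, an imaginary quadratic Heegner field `K` (`d_K ∉ {−3, −4}`), a frame `(Dt, β, ι)`, a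
square-free product `n₁` of Kolyvagin primes (W. Zhang's congruence form) and ONE Kolyvagin–Heegner
datum `d` of conductor `n₁` with `d.kolyvaginClass hp 1 ≠ 0`, and — points first, `ν = #{q ∣ n₁}` —
EITHER `ν + 1 ≤ rank E(ℚ)` (the non-zero class sits on the `+`-eigenspace: Kolyvagin's clause
`ν + 1 = rank E(ℚ) > rank E^{(d_K)}(ℚ)`) OR `ν ≤ rank E(ℚ) ∧ ν + 1 ≤ rank E^{(d_K)}(ℚ)` (it sits on the
`−`-eigenspace: the clause `ν = rank E(ℚ) = rank E^{(d_K)}(ℚ) − 1`, the only habitat of rank-`0`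
curves, `ν = 0`). WHY THIS DEFINITION: `KolyvaginDepthSupplyDatum` and `KolyvaginDepthSupplySystem`
kept the first clause only and are FALSE as stated (`not_kolyvaginDepthSupplyDatum`, file
`…KolyvaginDepthSupplyDatumFalse`: a rank-`0` non-CM curve); with the second clause restored the
statement is no longer refuted by rank-`0` curves, and it still implies X1 on non-CM curves modulo
(γ) [+ F1] through the two doors of a datum (`shaCorank_eq_zero_of_kolyvaginClass_ne_zero_of_rank_le_of_datum_…`
on the first clause, `…_of_twist_rank_of_datum_…` on the second, file `…DoorSecondSign`) with NO appeal
to Kolyvagin 1991 Thm. 4. A definition posited by this route's helpers; an OPEN class-wide statement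
(tagged `@[conjecture]`; modulo BCGS 2026 + Kolyvagin + GZK it is of the strength of X1 on non-CM
curves), NOT a published statement and NOT a ledger item. [cite: Kolyvagin1991MathAnn, Thm. 2.3 and Thm. 4 (the two eigenspaces)]
[cite: GrossLMS1991, §3–§5] [cite: WZhang2014, Notations (xii)] -/
@[conjecture] def KolyvaginDepthSupplySignedDatum : Prop :=
  ∀ (W : WeierstrassCurve ℚ) [W.IsElliptic] [W.IsGloballyMinimal], ¬ W.HasCM →
    ∃ (p : ℕ) (hp : Fact p.Prime), 5 ≤ p ∧ W.HasGoodReductionAtPrime p ∧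
      ¬ (p : ℤ) ∣ W.frobeniusTrace p ∧ (∀ n : ℕ, W.HasSurjectiveModNGaloisRep (p ^ n : ℕ)) ∧
      ∃ (K : Type) (_ : Field K) (_ : NumberField K), IsImaginaryQuadratic K ∧
        NumberField.discr K ≠ -3 ∧ NumberField.discr K ≠ -4 ∧
        ∃ (_ : NeZero (W.conductorNorm ℤ)), SatisfiesHeegnerHypothesis (W.conductorNorm ℤ) K ∧
        ∃ (Dt : ModularParametrizationData W (W.conductorNorm ℤ)) (β : ℤ) (ι : K →+* ℂ) (n₁ : ℕ)
          (d : KolyvaginHeegnerData Dt β ι n₁), Squarefree n₁ ∧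
            (∀ q ∈ n₁.primeFactors, Zhang2014.IsKolyvaginPrime (W.conductorNorm ℤ) W K p q) ∧
            d.kolyvaginClass hp.out 1 ≠ 0 ∧
            (n₁.primeFactors.card + 1 ≤ W.mordellWeilRank ∨
              (n₁.primeFactors.card ≤ W.mordellWeilRank ∧
                n₁.primeFactors.card + 1 ≤
                  (W.quadraticTwist (NumberField.discr K : ℚ)).mordellWeilRank))

/-- **`KolyvaginDepthSupplySignedDatumKN`** — the signed datum form ON THE KODAIRA–NÉRON CELL OF ITS OWN
WITNESS PRIME: `KolyvaginDepthSupplySignedDatum` above with one more conjunct on the witness `p`, the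
Kodaira–Néron side condition (KN_p) `p ∤ ord_v(Δ_min)` at every place `v` of multiplicative reduction of
`E/ℚ` (for `p ≥ 5` the additive clause of the doors is void). WHY: with (KN_p) in the witness, McCallum's
Lemma 4.3 is a THEOREM of the tree for the witness (`kolyvaginClass_mem_selmerLocalKer_finite_one_of_kodairaNeron`,
x11b3 / g8), so the signed datum reaches X1 on non-CM curves modulo the ONE named input (γ) =
`GrossLMS1991.prop37_2_frobeniusCongruence` — F1 = `Gross1991_heegnerPoint_sub_ratTorsion_mem_E0`
([GZ86 III (3.1)], XL) is no longer needed (`bsd_of_kolyvaginDepthSupplySignedDatumKN_print`, sibling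
file). The extra conjunct excludes only the finitely many primes dividing some `ord_v(Δ_min)`, so it
does not change the expected truth of the statement (the admissible primes are cofinite); it is still an
OPEN class-wide statement (tagged `@[conjecture]`), of the strength of «`Ш(E/ℚ)[p] = 0` at an admissible
prime» on non-CM curves, NOT a published statement and NOT a ledger item.
[cite: Kolyvagin1991MathAnn, Thm. 2.3 and Thm. 4] [cite: GrossLMS1991, §3–§5, Prop. 6.2 (1)]
[cite: SilvermanAEC2009, VII.6.1 (Kodaira–Néron)] [cite: WZhang2014, Notations (xii)] -/
@[conjecture] def KolyvaginDepthSupplySignedDatumKN : Prop :=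
  ∀ (W : WeierstrassCurve ℚ) [W.IsElliptic] [W.IsGloballyMinimal], ¬ W.HasCM →
    ∃ (p : ℕ) (hp : Fact p.Prime), 5 ≤ p ∧ W.HasGoodReductionAtPrime p ∧
      ¬ (p : ℤ) ∣ W.frobeniusTrace p ∧ (∀ n : ℕ, W.HasSurjectiveModNGaloisRep (p ^ n : ℕ)) ∧
      (∀ v : IsDedekindDomain.HeightOneSpectrum (NumberField.RingOfIntegers ℚ),
        W.HasMultiplicativeReductionAt v →
        ¬ p ∣ W.ordMinimalDiscriminant v) ∧
      ∃ (K : Type) (_ : Field K) (_ : NumberField K), IsImaginaryQuadratic K ∧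
        NumberField.discr K ≠ -3 ∧ NumberField.discr K ≠ -4 ∧
        ∃ (_ : NeZero (W.conductorNorm ℤ)), SatisfiesHeegnerHypothesis (W.conductorNorm ℤ) K ∧
        ∃ (Dt : ModularParametrizationData W (W.conductorNorm ℤ)) (β : ℤ) (ι : K →+* ℂ) (n₁ : ℕ)
          (d : KolyvaginHeegnerData Dt β ι n₁), Squarefree n₁ ∧
            (∀ q ∈ n₁.primeFactors, Zhang2014.IsKolyvaginPrime (W.conductorNorm ℤ) W K p q) ∧
            d.kolyvaginClass hp.out 1 ≠ 0 ∧
            (n₁.primeFactors.card + 1 ≤ W.mordellWeilRank ∨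
              (n₁.primeFactors.card ≤ W.mordellWeilRank ∧
                n₁.primeFactors.card + 1 ≤
                  (W.quadraticTwist (NumberField.discr K : ℚ)).mordellWeilRank))

end Summit.BirchSwinnertonDyer.BirchSwinnertonDyer.Theorems.KolyvaginDepthDoor

end
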